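import Summits.CriticalPhenomena.PercolationContinuityZ3.Theorems.PercNearOneGluingNoHeavyRsw3WMSFMeasurable
import HarnessLib

/-!
# RSW3 lane (P2, gen 30): THE WIRED MINIMAL SPANNING FOREST, IV — IDENTIFICATION OF THE MEASURABLE EVENTS: the infinite branch of the invasion
# tree at its root is EXACTLY the first backbone step (`ξ(o, y; T(o)) ⟺ y = R_o(1)`), and the forest cluster of `w` avoiding its parent is EXACTLY
# the set of descendants of `w` (`ξ(par w, w; 𝔉_w) ⟺ w` is a trunk vertex)

builds on p205010 (kernel theorem, internal audit signed; external expert review pending) — NOT used in this file.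

Cell `prim-rsw3`, prover seat `prim-rsw3-p2` (gen 30), memo `run/shared/lean/prim/rsw3/P2-RSWLITE.md` §37.  Support file
(`--supports stmt-CriticalPhenomena-4575`); no definitions, no named facts, no sorries.  Fourth file of the programme "every component of `𝔉_w(ℤ^d)` has
EXACTLY ONE end" (Lyons–Peres 2016 Thm. 11.12).  The mass transports of the last two steps are indicators of events written with the Barriers library's
`InfBranch` (measurable and equivariant by file III); here those events are identified, deterministically, with the combinatorial notions of files I–II.

* §1 `infBranch_treeEdges_ray_one`, **`infBranch_treeEdges_iff_eq_ray_one`** — for the invasion tree `T(o)` of an infinite connected locally finite graph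
  with outlets beyond every time and backbone `R` from `o`: the branch of a neighbour `y` of `o` (its cluster in `T(o) − o`) is infinite iff `y = R 1`
  (every other branch lies on the root's side `I_m` of any outlet bond — finite — because the far side hangs off the backbone).
* §2 (an acyclic `openGraph ω` with a coherent tail-sharing ray field `R`, `par w = R w 1`): **`mem_openClusterIn_avoid_parent_iff_desc`** — `u` lies in the
  `ω`-cluster of `w` avoiding `par w` iff `u` DESCENDS from `w` (`∃ i, R u i = w`); hence **`infBranch_parent_iff_trunk`** — `ξ(par w, w; ω)` iff `w` is a
  trunk vertex.

References: R. Lyons, Y. Peres, *Probability on Trees and Networks* (2016), Prop. 8.18 (ξ), Thm. 11.12 [LyonsPeres2016]; R. Lyons, Y. Peres, O. Schramm,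
Ann. Probab. 34 (2006) Thm. 3.12 [LyonsPeresSchramm2006].
-/

noncomputable section

namespace Summit.CriticalPhenomena.PercolationContinuityZ3.Theorems.Rsw3

open Finset Filter MeasureTheory Literature.Probability.LatticeModels Literature.Probability.Percolation
open Literature.Probability.Percolation.Invasion Literature.Barriers.CriticalPhenomena

section General

variable {V : Type*} [DecidableEq V] {G : SimpleGraph V} [G.LocallyFinite]

/-! ## §0 Walks avoiding a vertex -/

omit [DecidableEq V] [G.LocallyFinite] in
/-- A vertex reachable from `y ≠ o` by steps avoiding `o` is not `o`. [folklore] -/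
theorem ne_of_reachable_avoid {H : SimpleGraph V} {o y x : V} (h : (H ⊓ withinGraph ⊤ ({o} : Set V)ᶜ).Reachable y x) (hy : y ≠ o) :
    x ≠ o := by
  obtain ⟨p⟩ := h
  induction p with
  | nil => exact hy
  | cons hadj _ ih =>
    refine ih ?_
    rw [SimpleGraph.inf_adj, withinGraph_adj] at hadj
    exact hadj.2.2.2

omit [DecidableEq V] [G.LocallyFinite] in
/-- A walk all of whose vertices lie in `S` is a walk with steps inside `S`. [folklore] -/
theorem reachable_inf_withinGraph_of_walk {H : SimpleGraph V} {S : Set V} :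
    ∀ {u v : V} (p : H.Walk u v), (∀ x ∈ p.support, x ∈ S) → (H ⊓ withinGraph ⊤ S).Reachable u v
  | _, _, SimpleGraph.Walk.nil, _ => SimpleGraph.Reachable.refl _
  | _, _, SimpleGraph.Walk.cons (v := w) hadj p, hp => by
    have hu := hp _ (SimpleGraph.Walk.start_mem_support _)
    have hw : w ∈ S := hp w (by simp)
    refine (SimpleGraph.Adj.reachable ?_).trans (reachable_inf_withinGraph_of_walk p fun x hx => hp x (by simp [hx]))
    rw [SimpleGraph.inf_adj, withinGraph_adj]
    exact ⟨hadj, (SimpleGraph.top_adj _ _).2 hadj.ne, hu, hw⟩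

/-! ## §1 The infinite branch at the root of the invasion tree is the first backbone step -/

/-- Along the backbone, `R 1, R 2, …` lie in the branch of `R 1` at the root: `(T(o) − o)`-paths from `R 1` to every `R (k+1)`.
[cite: LyonsPeres2016, Prop. 8.18 (ξ) and Thm. 11.12 (proof)] -/
theorem ray_succ_mem_openClusterIn {U : Sym2 V → ℝ} {o : V} {R : ℕ → V} (hR : Function.Injective R) (hR0 : R 0 = o)
    (hRadj : ∀ i, (tree G U o).Adj (R i) (R (i + 1))) (k : ℕ) :
    R (k + 1) ∈ openClusterIn (withinGraph ⊤ ({o} : Set V)ᶜ) (treeEdges G U o) (R 1) := by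
  rw [mem_openClusterIn_iff]
  have hne : ∀ j, R (j + 1) ≠ o := fun j h => by have := hR (h.trans hR0.symm); omega
  induction k with
  | zero => exact SimpleGraph.Reachable.refl _
  | succ k ih =>
    refine ih.trans (SimpleGraph.Adj.reachable ?_)
    rw [SimpleGraph.inf_adj, openGraph_adj, withinGraph_adj]
    obtain ⟨hmem, hne'⟩ := (tree_adj G).1 (hRadj (k + 1))
    exact ⟨⟨hmem, hne'⟩, (SimpleGraph.top_adj _ _).2 hne', hne k, hne (k + 1)⟩

/-- **`ξ(o, R 1; T(o))` holds**: the branch of the first backbone vertex at the root is infinite. [cite: LyonsPeres2016, Prop. 8.18 (ξ)] -/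
theorem infBranch_treeEdges_ray_one {U : Sym2 V → ℝ} {o : V} {R : ℕ → V} (hR : Function.Injective R) (hR0 : R 0 = o)
    (hRadj : ∀ i, (tree G U o).Adj (R i) (R (i + 1))) : InfBranch (treeEdges G U o) o (R 1) := by
  obtain ⟨hmem, hne⟩ := (tree_adj G).1 (hRadj 0)
  rw [hR0] at hmem hne
  refine ⟨hmem, hne, ?_⟩
  show (openClusterIn (withinGraph ⊤ ({o} : Set V)ᶜ) (treeEdges G U o) (R 1)).Infinite
  refine (Set.infinite_range_of_injective (f := fun k => R (k + 1)) fun i j h => by simpa using hR h).mono ?_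
  rintro _ ⟨k, rfl⟩
  exact ray_succ_mem_openClusterIn hR hR0 hRadj k

/-- A walk in the invasion tree with an outlet bond removed, starting at the far endpoint of that bond, never visits the root.
[cite: LyonsPeresSchramm2006, Thm. 3.12 (proof: the outlet bond separates o from infinity)] -/
theorem ne_root_of_mem_support_far {U : Sym2 V → ℝ} {o : V} {m : ℕ} (hm : IsOutlet G U o m) {a : V × V}
    (ha : newDart G U (invasion G U o m) = some a) {z : V} (p : ((tree G U o).deleteEdges {s(a.1, a.2)}).Walk a.2 z) :
    ∀ x ∈ p.support, x ≠ o := by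
  classical
  intro x hx hxo
  subst hxo
  have hreach : ((tree G U x).deleteEdges {s(a.1, a.2)}).Reachable x a.2 := ⟨(p.takeUntil x hx).reverse⟩
  exact snd_not_mem_of_newDart ha ((reachable_deleteEdges_outlet_iff hm ha).1 hreach)

/-- **`ξ(o, y; T(o)) ⟺ y = R 1`** (infinite connected locally finite graph, outlets beyond every time, `R` the backbone from `o`): the branch at the root of any
neighbour `y ≠ R 1` is contained in the root's side `I_m` of an outlet bond — it is disjoint from the branch of `R 1` (acyclicity), which contains the far
side — hence finite. [cite: LyonsPeres2016, Prop. 8.18 (ξ) and Thm. 11.12 (proof)] [cite: LyonsPeresSchramm2006, Thm. 3.12 (proof)] -/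
theorem infBranch_treeEdges_iff_eq_ray_one [Infinite V] (hG : G.Preconnected) {U : Sym2 V → ℝ} {o : V}
    (hout : ∀ k, ∃ m, k ≤ m ∧ IsOutlet G U o m) {R : ℕ → V} (hR : Function.Injective R) (hR0 : R 0 = o)
    (hRadj : ∀ i, (tree G U o).Adj (R i) (R (i + 1))) (y : V) : InfBranch (treeEdges G U o) o y ↔ y = R 1 := by
  classical
  refine ⟨fun h => ?_, fun h => h ▸ infBranch_treeEdges_ray_one hR hR0 hRadj⟩
  by_contra hy
  obtain ⟨hmem, hoy, hinf⟩ := h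
  obtain ⟨m, -, hm⟩ := hout 0
  obtain ⟨a, ha⟩ := exists_newDart_eq_some (boundaryDarts_invasion_nonempty hG U o m)
  obtain ⟨i, -, -, hi2⟩ := ray_crosses_outlet hm ha hR hR0 hRadj
  set T := tree G U o with hT
  set K : SimpleGraph V := withinGraph ⊤ ({o} : Set V)ᶜ with hK
  have hTo : openGraph (treeEdges G U o) = T := rfl
  have hTac : T.IsAcyclic := tree_isAcyclic U o
  have hyo : T.Adj y o := (tree_adj G).2 ⟨by rw [Sym2.eq_swap]; exact hmem, hoy.symm⟩
  have hoR : T.Adj o (R 1) := by have := hRadj 0; rwa [hR0] at this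
  have hyR : y ≠ R 1 := hy
  -- (1) the branches of `y` and of `R 1` at `o` are disjoint
  have hdisj : ∀ z, z ∈ openClusterIn K (treeEdges G U o) y → z ∉ openClusterIn K (treeEdges G U o) (R 1) := by
    intro z hzy hzR
    rw [mem_openClusterIn_iff, hTo] at hzy hzR
    obtain ⟨q⟩ := hzy.trans hzR.symm
    have hsupp : ∀ x ∈ q.support, x ≠ o := fun x hx =>
      ne_of_reachable_avoid (H := T) ⟨q.takeUntil x hx⟩ hoy.symm
    -- the path version of `q`, carried to `T`, versus the path `y, o, R 1`
    have hq₀E : ∀ e ∈ (q.toPath : (T ⊓ K).Walk y (R 1)).edges, e ∈ T.edgeSet := fun e he =>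
      SimpleGraph.edgeSet_mono inf_le_left ((q.toPath : (T ⊓ K).Walk y (R 1)).edges_subset_edgeSet he)
    let q₁ : T.Walk y (R 1) := (q.toPath : (T ⊓ K).Walk y (R 1)).transfer T hq₀E
    have hq₁ : q₁.IsPath := q.toPath.2.transfer _
    have hq₁supp : ∀ x ∈ q₁.support, x ≠ o := by
      intro x hx
      rw [SimpleGraph.Walk.support_transfer] at hx
      exact hsupp x (q.support_toPath_subset_support hx)
    let r : T.Walk y (R 1) := SimpleGraph.Walk.cons hyo (SimpleGraph.Walk.cons hoR SimpleGraph.Walk.nil)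
    have hr : r.IsPath := by
      refine (SimpleGraph.Walk.IsPath.nil.cons ?_).cons ?_
      · rw [SimpleGraph.Walk.support_nil, List.mem_singleton]; exact hoR.ne
      · rw [SimpleGraph.Walk.support_cons, SimpleGraph.Walk.support_nil, List.mem_cons, List.mem_singleton]
        rintro (h | h)
        · exact hoy h.symm
        · exact hyR h
    have hrq : (⟨q₁, hq₁⟩ : T.Path y (R 1)) = ⟨r, hr⟩ := hTac.path_unique _ _
    have hmem_o : o ∈ q₁.support := by
      rw [show q₁ = r from congrArg Subtype.val hrq]
      simp [r]
    exact hq₁supp o hmem_o rfl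
  -- (2) every vertex of the branch of `y` lies in `I_m`
  have hsub : openClusterIn K (treeEdges G U o) y ⊆ ↑(invasion G U o m) := by
    intro z hzy
    by_contra hzm
    rw [Finset.mem_coe] at hzm
    -- `z` is invaded: it is `T`-reachable from `o`
    have hzreach : T.Reachable o z := by
      have h1 := hzy
      rw [mem_openClusterIn_iff, hTo] at h1
      exact hyo.symm.reachable.trans (h1.mono inf_le_left)
    obtain ⟨n, hzn⟩ := (mem_invadedRegion G).1 ((tree_reachable_iff_mem_invadedRegion).1 hzreach)
    -- far side: joined to `a.2` avoiding the outlet bond, hence avoiding `o`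
    obtain ⟨p⟩ := reachable_deleteEdges_outlet_snd hm ha hzn hzm
    have hfar : (T ⊓ K).Reachable a.2 z := by
      have h := reachable_inf_withinGraph_of_walk (S := ({o} : Set V)ᶜ) p fun x hx => ne_root_of_mem_support_far hm ha p x hx
      exact h.mono (inf_le_inf_right _ (SimpleGraph.deleteEdges_le _))
    -- so `z` is in the branch of `R 1`
    have hzR : z ∈ openClusterIn K (treeEdges G U o) (R 1) := by
      rw [mem_openClusterIn_iff, hTo]
      have h1 := ray_succ_mem_openClusterIn hR hR0 hRadj i
      rw [mem_openClusterIn_iff, hTo, hi2] at h1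
      exact h1.trans hfar
    exact hdisj z hzy hzR
  exact hinf ((invasion G U o m).finite_toSet.subset hsub)

/-! ## §2 The forest cluster avoiding the parent is the set of descendants -/

section RayField

variable {ω : BondConfig V} {R : V → ℕ → V}

omit [DecidableEq V] [G.LocallyFinite] in
/-- One step of a walk avoiding `par w`: descent from `w` propagates to the next vertex (orientation of the bond, file II). [cite: LyonsPeres2016, Thm. 11.12 (proof)] -/
theorem desc_of_adj_avoid (hF : (openGraph ω).IsAcyclic) (h0 : ∀ v, R v 0 = v) (hinj : ∀ v, Function.Injective (R v))
    (hadj : ∀ v i, (openGraph ω).Adj (R v i) (R v (i + 1))) (hcoh : ∀ v i k, R (R v i) k = R v (i + k))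
    (htail : ∀ x y, (openGraph ω).Adj x y → ∃ a b, ∀ k, R x (a + k) = R y (b + k))
    {w x x' : V} (hxx' : (openGraph ω ⊓ withinGraph ⊤ ({R w 1} : Set V)ᶜ).Adj x x') (hx : ∃ i, R x i = w) : ∃ i, R x' i = w := by
  rw [SimpleGraph.inf_adj, withinGraph_adj] at hxx'
  obtain ⟨hF', -, -, hx'p⟩ := hxx'
  obtain ⟨i, hi⟩ := hx
  rcases parent_or_parent_of_adj hF h0 hinj hadj hF' (htail _ _ hF') with h | h
  · -- `par x = x'`
    rcases Nat.eq_zero_or_pos i with rfl | hi0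
    · rw [h0] at hi
      subst hi
      exact absurd (Set.mem_singleton_iff.2 h.symm) hx'p
    · refine ⟨i - 1, ?_⟩
      rw [← h, hcoh, show 1 + (i - 1) = i by omega, hi]
  · -- `par x' = x`
    exact ⟨1 + i, by rw [← hcoh x' 1 i, h, hi]⟩

omit [DecidableEq V] [G.LocallyFinite] in
/-- **THE CLUSTER OF `w` AVOIDING ITS PARENT IS THE SET OF DESCENDANTS OF `w`** (acyclic `openGraph ω` with a coherent tail-sharing ray field `R`):
`u ∈ openClusterIn (withinGraph ⊤ {R w 1}ᶜ) ω w ⟺ ∃ i, R u i = w`. [cite: LyonsPeres2016, Thm. 11.12 (proof: the trunk)] [cite: LyonsPeres2016, Prop. 8.18 (ξ)] -/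
theorem mem_openClusterIn_avoid_parent_iff_desc (hF : (openGraph ω).IsAcyclic) (h0 : ∀ v, R v 0 = v) (hinj : ∀ v, Function.Injective (R v))
    (hadj : ∀ v i, (openGraph ω).Adj (R v i) (R v (i + 1))) (hcoh : ∀ v i k, R (R v i) k = R v (i + k))
    (htail : ∀ x y, (openGraph ω).Adj x y → ∃ a b, ∀ k, R x (a + k) = R y (b + k)) (w u : V) :
    u ∈ openClusterIn (withinGraph ⊤ ({R w 1} : Set V)ᶜ) ω w ↔ ∃ i, R u i = w := by
  rw [mem_openClusterIn_iff]
  constructor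
  · rintro ⟨p⟩
    -- descent propagates along the walk from `w`
    suffices h : ∀ {a b : V} (q : (openGraph ω ⊓ withinGraph ⊤ ({R w 1} : Set V)ᶜ).Walk a b), (∃ i, R a i = w) → ∃ i, R b i = w from
      h p ⟨0, h0 w⟩
    intro a b q
    induction q with
    | nil => exact id
    | cons hadj' _ ih => exact fun ha => ih (desc_of_adj_avoid hF h0 hinj hadj hcoh htail hadj' ha)
  · rintro ⟨i, hi⟩
    -- the backbone of `u` from `u` to `R u i = w` avoids `R w 1 = R u (i+1)`
    have hp : R w 1 = R u (i + 1) := by rw [← hi, hcoh]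
    have hne : ∀ j, j ≤ i → R u j ≠ R w 1 := fun j hj h => by
      rw [hp] at h; have := hinj u h; omega
    have hreach : ∀ j, j ≤ i → (openGraph ω ⊓ withinGraph ⊤ ({R w 1} : Set V)ᶜ).Reachable u (R u j) := by
      intro j hj
      induction j with
      | zero => rw [h0]
      | succ j ih =>
        refine (ih (by omega)).trans (SimpleGraph.Adj.reachable ?_)
        rw [SimpleGraph.inf_adj, withinGraph_adj]
        exact ⟨hadj u j, (SimpleGraph.top_adj _ _).2 (hadj u j).ne, hne j (by omega), hne (j + 1) hj⟩
    have := hreach i le_rfl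
    rw [hi] at this
    exact this.symm

omit [DecidableEq V] [G.LocallyFinite] in
/-- **`ξ(par w, w; ω) ⟺ w` IS A TRUNK VERTEX** (infinitely many descendants), for a vertex `w` whose parent bond is in `ω`.
[cite: LyonsPeres2016, Prop. 8.18 (ξ) and Thm. 11.12 (proof: the trunk)] -/
theorem infBranch_parent_iff_trunk (hF : (openGraph ω).IsAcyclic) (h0 : ∀ v, R v 0 = v) (hinj : ∀ v, Function.Injective (R v))
    (hadj : ∀ v i, (openGraph ω).Adj (R v i) (R v (i + 1))) (hcoh : ∀ v i k, R (R v i) k = R v (i + k))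
    (htail : ∀ x y, (openGraph ω).Adj x y → ∃ a b, ∀ k, R x (a + k) = R y (b + k)) (w : V) :
    InfBranch ω (R w 1) w ↔ {u | ∃ i, R u i = w}.Infinite := by
  have hset : openClusterIn (withinGraph ⊤ ({R w 1} : Set V)ᶜ) ω w = {u | ∃ i, R u i = w} :=
    Set.ext fun u => mem_openClusterIn_avoid_parent_iff_desc hF h0 hinj hadj hcoh htail w u
  have hadj0 := hadj w 0
  rw [h0, openGraph_adj] at hadj0
  unfold InfBranch
  rw [show (ω ∈ percolatesVia (withinGraph ⊤ ({R w 1} : Set V)ᶜ) w) ↔ (openClusterIn (withinGraph ⊤ ({R w 1} : Set V)ᶜ) ω w).Infinite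
    from Iff.rfl, hset]
  refine ⟨fun h => h.2.2, fun h => ⟨by rw [Sym2.eq_swap]; exact hadj0.1, hadj0.2.symm, h⟩⟩

end RayField

end General

end Summit.CriticalPhenomena.PercolationContinuityZ3.Theorems.Rsw3
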